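import Literature.Barriers.Parity.SiegelZeroDichotomyChowlaStep3Cutoff
import Literature.Barriers.Parity.SiegelZeroDichotomyPairHLSiegelModel
import HarnessLib

/-!
# Tao–Teräväinen 2022, Lemma 8.2, first half: the Fourier representation (8.10) of `ψ_{≤R}`

Topic `Literature/Barriers/Parity`, sub-namespace `TaoTeravainen.MainTerm`; a file of the
Goldston–Yıldırım-type computation (8.8)–(8.25) of Tao–Teräväinen (arXiv:2109.06291, §8), in the proof
DAG of `Literature.Barriers.Parity.TaoTeravainen2021_prop72_81_pair`. Everything here is PROVED.

Lemma 8.2 (Fourier expansion), first half: "(8.10) `ψ_{≤R}(d) = ∫_ℝ d^{-(1+it)/log R} f(t) dt` …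
for some measurable `f` obeying (8.12) `f(t) ≪_m (1+|t|)^{-m}` … as well as (8.14) `∫ f(t) dt = 1`.
Proof. From (2.22) and (3.14) we obtain (8.10) with `f(t) := (1/2π) ∫ e^{(1+it)u} ψ(u) du` the Fourier
transform of `u ↦ e^u ψ(u)`. From repeated integration by parts we have the rapid decrease (8.12),
while from (3.15) we have `∫ f = e^0 ψ(0) = 1` giving (8.14)."

Unlike the tail representation of the tree (`cutoffFourier` = `𝓕(e^{-u}(1-ψ))`,
`cutoffLE_eq_one_sub_integral`: `ψ_{≤R}(e) = 1 - ∫ e^{s_t} f`), which suffices for upper bounds, the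
main-term computation needs the source's own form with the convergence factor `d^{-1/log R}`:

* `leKernel ψ u = e^u ψ(u)` (smooth, supported in `[-1, 1]`), `leFourier ψ = 𝓕 leKernel` (Mathlib's
  `𝓕`, kernel `e^{-2πi t u}`);
* `leFourier_decay` — for each `A`, `(1 + |t|)^A ‖leFourier ψ t‖ ≤ C(ψ, A)` ((8.12));
  `continuous_leFourier`, `integrable_pow_mul_norm_leFourier`;
* `psi_eq_exp_neg_mul_integral` — `ψ(v) = e^{-v} ∫ e^{2πitv} leFourier ψ t dt` for all
  real `v` (Fourier inversion), hence (8.14) `∫ leFourier ψ = ψ(0) = 1` (`integral_leFourier`), and the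
  applied form (8.10): `cutoffLE_eq_integral` —
  `ψ_{≤R}(d) = ∫ d^{-(1 - 2πit)/log R} leFourier ψ t dt` for `d ≥ 1`, `R > 1`
  (`cutoffLE` of `SiegelZeroDichotomyPairHLSiegelModel.lean`; the sign of `t` is immaterial).
  [cite: TaoTeravainen2021, Lemma 8.2 ((8.10), (8.12), (8.14)) and its proof]
-/

noncomputable section

open Real MeasureTheory Set Filter
open scoped FourierTransform Topology ContDiff

namespace Literature.Barriers.Parity

namespace TaoTeravainen

namespace MainTerm

variable {ψ : ℝ → ℝ}

/-! ### The kernel `e^u ψ(u)` -/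

/-- `leKernel ψ u = e^u ψ(u)` ("the Fourier transform of `u ↦ e^u ψ(u)`").
[cite: TaoTeravainen2021, proof of Lemma 8.2] -/
def leKernel (ψ : ℝ → ℝ) (u : ℝ) : ℝ :=
  Real.exp u * ψ u

/-- `e^u ψ(u)` is smooth. [folklore] -/
theorem contDiff_leKernel (hψ : IsSmoothCutoff ψ) : ContDiff ℝ ∞ (leKernel ψ) :=
  Real.contDiff_exp.mul hψ.contDiff

/-- `e^u ψ(u) = 0` for `|u| ≥ 1`. [cite: TaoTeravainen2021, §2.5 ("ψ supported on [-1,1]")] -/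
theorem leKernel_eq_zero (hψ : IsSmoothCutoff ψ) {u : ℝ} (hu : 1 ≤ |u|) :
    leKernel ψ u = 0 := by
  rw [leKernel, hψ.eq_zero u hu, mul_zero]

/-- Near a point with `|u| > 1` the kernel vanishes identically. [folklore] -/
theorem leKernel_eventuallyEq_zero (hψ : IsSmoothCutoff ψ) {u : ℝ} (hu : 1 < |u|) :
    leKernel ψ =ᶠ[𝓝 u] fun _ => (0 : ℝ) := by
  have hopen : IsOpen {w : ℝ | 1 < |w|} := isOpen_lt continuous_const continuous_abs
  exact Filter.eventually_of_mem (hopen.mem_nhds hu) fun w hw => leKernel_eq_zero hψ (le_of_lt hw)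

/-- All derivatives of the kernel vanish where `|u| > 1`. [folklore] -/
theorem iteratedDeriv_leKernel_eq_zero (hψ : IsSmoothCutoff ψ) (n : ℕ) {u : ℝ}
    (hu : 1 < |u|) : iteratedDeriv n (leKernel ψ) u = 0 := by
  rw [(leKernel_eventuallyEq_zero hψ hu).iteratedDeriv_eq n, iteratedDeriv_const]
  simp

/-- The derivatives of the kernel have compact support (in `[-1, 1]`). [folklore] -/
theorem hasCompactSupport_iteratedDeriv_leKernel (hψ : IsSmoothCutoff ψ) (n : ℕ) :
    HasCompactSupport (iteratedDeriv n (leKernel ψ)) := by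
  refine HasCompactSupport.of_support_subset_isCompact (isCompact_Icc (a := -1) (b := 1)) ?_
  intro u hu
  by_contra h
  rw [mem_Icc, not_and_or, not_le, not_le] at h
  have : 1 < |u| := by
    rcases h with h | h
    · rw [abs_of_neg (by linarith)]; linarith
    · rw [abs_of_pos (by linarith)]; linarith
  exact hu (iteratedDeriv_leKernel_eq_zero hψ n this)

/-- The derivatives of the kernel are continuous. [folklore] -/
theorem continuous_iteratedDeriv_leKernel (hψ : IsSmoothCutoff ψ) (n : ℕ) :
    Continuous (iteratedDeriv n (leKernel ψ)) :=
  (contDiff_leKernel hψ).continuous_iteratedDeriv n (by exact_mod_cast le_top)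

/-- The derivatives of the kernel are integrable. [folklore] -/
theorem integrable_iteratedDeriv_leKernel (hψ : IsSmoothCutoff ψ) (n : ℕ) :
    Integrable (iteratedDeriv n (leKernel ψ)) :=
  (continuous_iteratedDeriv_leKernel hψ n).integrable_of_hasCompactSupport
    (hasCompactSupport_iteratedDeriv_leKernel hψ n)

/-! ### The Fourier transform and its decay -/

/-- **The source's `f` of (8.10)** (up to `t ↦ -2πt`): `leFourier ψ t = ∫ e^{-2πi u t} e^u ψ(u) du`.
[cite: TaoTeravainen2021, Lemma 8.2 (8.10)] -/
def leFourier (ψ : ℝ → ℝ) : ℝ → ℂ :=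
  𝓕 (fun u : ℝ => (leKernel ψ u : ℂ))

/-- **(8.12): decay of `f` to all orders**: for each `A` there is `C = C(ψ, A)` with
`(1 + |t|)^A ‖f(t)‖ ≤ C` ("From repeated integration by parts we have the rapid decrease (8.12)";
here `(2π|t|)ⁿ ‖𝓕 G(t)‖ = ‖𝓕 G⁽ⁿ⁾(t)‖ ≤ ∫ |G⁽ⁿ⁾|` with `n = 0` and `n = A`).
[cite: TaoTeravainen2021, Lemma 8.2 (8.12)] -/
theorem leFourier_decay (hψ : IsSmoothCutoff ψ) (A : ℕ) :
    ∃ C : ℝ, 0 ≤ C ∧ ∀ t : ℝ, (1 + |t|) ^ A * ‖leFourier ψ t‖ ≤ C := by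
  set gc : ℝ → ℂ := fun u => (leKernel ψ u : ℂ) with hgc
  have hgc_smooth : ContDiff ℝ ∞ gc := Complex.ofRealCLM.contDiff.comp (contDiff_leKernel hψ)
  have hder : ∀ n : ℕ, iteratedDeriv n gc = fun u => ((iteratedDeriv n (leKernel ψ) u : ℝ) : ℂ) :=
    fun n => iteratedDeriv_ofReal_comp (contDiff_leKernel hψ) n
  have hint : ∀ n : ℕ, Integrable (iteratedDeriv n gc) := fun n => by
    rw [hder n]
    exact (integrable_iteratedDeriv_leKernel hψ n).ofReal
  set K : ℕ → ℝ := fun n => ∫ u, ‖iteratedDeriv n gc u‖ with hK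
  have hK0 : ∀ n, 0 ≤ K n := fun n => integral_nonneg fun _ => norm_nonneg _
  refine ⟨2 ^ A * (K 0 + K A / (2 * π) ^ A), by have := hK0 0; have := hK0 A; positivity, fun t => ?_⟩
  have hbound : ∀ n : ℕ, (2 * π * |t|) ^ n * ‖leFourier ψ t‖ ≤ K n := by
    intro n
    have hF := Real.fourier_iteratedDeriv (N := (⊤ : ℕ∞)) hgc_smooth (fun m _ => hint m)
      (n := n) le_top
    have h1 : ‖𝓕 (iteratedDeriv n gc) t‖ ≤ ∫ u, ‖iteratedDeriv n gc u‖ :=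
      VectorFourier.norm_fourierIntegral_le_integral_norm _ _ _ _ _
    rw [hF, norm_smul, norm_pow] at h1
    have h2 : ‖(2 * π * Complex.I * t : ℂ)‖ = 2 * π * |t| := by
      simp [abs_of_pos Real.pi_pos]
    rw [h2] at h1
    exact h1
  have h0 := hbound 0; have hA := hbound A; rw [pow_zero, one_mul] at h0
  have hpi : 0 < (2 * π) ^ A := by positivity
  have hA' : |t| ^ A * ‖leFourier ψ t‖ ≤ K A / (2 * π) ^ A := by
    rw [mul_pow] at hA
    rw [le_div_iff₀ hpi]
    linarith
  have hconv : (1 + |t|) ^ A ≤ 2 ^ A * (1 + |t| ^ A) := by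
    have h1 : 1 + |t| ≤ 2 * max 1 |t| := by
      rcases le_or_gt 1 |t| with h | h
      · rw [max_eq_right h]; linarith
      · rw [max_eq_left h.le]; linarith
    calc (1 + |t|) ^ A ≤ (2 * max 1 |t|) ^ A := pow_le_pow_left₀ (by positivity) h1 A
      _ = 2 ^ A * max 1 |t| ^ A := mul_pow _ _ _
      _ ≤ 2 ^ A * (1 + |t| ^ A) := by
          gcongr
          rcases le_or_gt 1 |t| with h | h
          · rw [max_eq_right h]; linarith
          · rw [max_eq_left h.le, one_pow]; linarith [pow_nonneg (abs_nonneg t) A]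
  calc (1 + |t|) ^ A * ‖leFourier ψ t‖ ≤ 2 ^ A * (1 + |t| ^ A) * ‖leFourier ψ t‖ := by gcongr
    _ = 2 ^ A * (‖leFourier ψ t‖ + |t| ^ A * ‖leFourier ψ t‖) := by ring
    _ ≤ 2 ^ A * (K 0 + K A / (2 * π) ^ A) := by gcongr

/-- `f` is continuous. [folklore] -/
theorem continuous_leFourier (hψ : IsSmoothCutoff ψ) : Continuous (leFourier ψ) := by
  have hint : Integrable fun u : ℝ => (leKernel ψ u : ℂ) := by
    have := integrable_iteratedDeriv_leKernel hψ 0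
    rw [iteratedDeriv_zero] at this
    exact this.ofReal
  exact VectorFourier.fourierIntegral_continuous Real.continuous_fourierChar
    (by exact continuous_inner) hint

/-- `(1 + |t|)^A ‖f(t)‖` is integrable (from the decay at order `A + 2`). [folklore] -/
theorem integrable_pow_mul_norm_leFourier (hψ : IsSmoothCutoff ψ) (A : ℕ) :
    Integrable fun t : ℝ => (1 + |t|) ^ A * ‖leFourier ψ t‖ := by
  obtain ⟨C, hC0, hC⟩ := leFourier_decay hψ (A + 2)
  have hdom : Integrable fun t : ℝ => C * (1 + ‖t‖) ^ (-(2 : ℝ)) :=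
    (integrable_one_add_norm (by rw [Module.finrank_self]; norm_num)).const_mul _
  refine hdom.mono' ?_ (ae_of_all _ fun t => ?_)
  · exact (Continuous.mul (by fun_prop) (continuous_leFourier hψ).norm).aestronglyMeasurable
  · rw [Real.norm_eq_abs, abs_of_nonneg (by positivity), Real.norm_eq_abs]
    rw [Real.rpow_neg (by positivity), ← div_eq_mul_inv, le_div_iff₀ (by positivity),
      show ((1 : ℝ) + |t|) ^ (2 : ℝ) = (1 + |t|) ^ 2 by norm_cast]
    calc (1 + |t|) ^ A * ‖leFourier ψ t‖ * (1 + |t|) ^ 2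
        = (1 + |t|) ^ (A + 2) * ‖leFourier ψ t‖ := by ring
      _ ≤ C := hC t

/-- `f` is integrable. [folklore] -/
theorem integrable_leFourier (hψ : IsSmoothCutoff ψ) : Integrable (leFourier ψ) := by
  have h := integrable_pow_mul_norm_leFourier hψ 0
  simp only [pow_zero, one_mul] at h
  exact (integrable_norm_iff (continuous_leFourier hψ).aestronglyMeasurable).mp h

/-- `t ↦ (1+|t|)^A f(t)` is integrable (as a `ℂ`-valued function), every `A`. [folklore] -/
theorem integrable_pow_mul_leFourier (hψ : IsSmoothCutoff ψ) (A : ℕ) :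
    Integrable fun t : ℝ => ((1 + |t|) ^ A : ℝ) * leFourier ψ t := by
  have h := integrable_pow_mul_norm_leFourier hψ A
  refine h.mono' ?_ (ae_of_all _ fun t => ?_)
  · exact (Continuous.mul (by fun_prop) (continuous_leFourier hψ)).aestronglyMeasurable
  · rw [norm_mul, Complex.norm_real, Real.norm_of_nonneg (by positivity)]

/-! ### Fourier inversion: (8.10) and (8.14) -/

/-- **The Fourier representation of the cutoff**: for every real `v`,
`ψ(v) = e^{-v} ∫ e^{2πi t v} f(t) dt` (Fourier inversion for the smooth compactly supported `e^u ψ(u)`).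
[cite: TaoTeravainen2021, Lemma 8.2 (proof of (8.10), via (3.14))] -/
theorem psi_eq_exp_neg_mul_integral (hψ : IsSmoothCutoff ψ) (v : ℝ) :
    ((ψ v : ℝ) : ℂ) =
      Real.exp (-v) * ∫ t : ℝ, Complex.exp (↑(2 * π * (t * v)) * Complex.I) * leFourier ψ t := by
  set gc : ℝ → ℂ := fun w => (leKernel ψ w : ℂ) with hgc
  have hcont : Continuous gc := Complex.continuous_ofReal.comp (contDiff_leKernel hψ).continuous
  have hint : Integrable gc := by
    have := integrable_iteratedDeriv_leKernel hψ 0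
    rw [iteratedDeriv_zero] at this
    exact this.ofReal
  have hinv := congr_fun (hcont.fourierInv_fourier_eq hint (integrable_leFourier hψ)) v
  rw [Real.fourierInv_eq'] at hinv
  have hgv : gc v = ((Real.exp v * ψ v : ℝ) : ℂ) := rfl
  rw [hgv] at hinv
  have hexp : (Real.exp (-v) : ℂ) * (Real.exp v : ℂ) = 1 := by
    rw [← Complex.ofReal_mul, ← Real.exp_add, neg_add_cancel, Real.exp_zero, Complex.ofReal_one]
  calc ((ψ v : ℝ) : ℂ) = Real.exp (-v) * ((Real.exp v * ψ v : ℝ) : ℂ) := by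
        rw [Complex.ofReal_mul (Real.exp v), ← mul_assoc, hexp, one_mul]
    _ = Real.exp (-v) * ∫ t : ℝ, Complex.exp (↑(2 * π * (t * v)) * Complex.I) * leFourier ψ t := by
        rw [← hinv]
        congr 1
        refine integral_congr_ae (ae_of_all _ fun t => ?_)
        simp only [RCLike.inner_apply, conj_trivial, smul_eq_mul, leFourier, hgc]
        ring_nf

/-- **(8.14): `∫ f(t) dt = ψ(0) = 1`.** [cite: TaoTeravainen2021, Lemma 8.2 (8.14)] -/
theorem integral_leFourier (hψ : IsSmoothCutoff ψ) : ∫ t : ℝ, leFourier ψ t = 1 := by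
  have h := psi_eq_exp_neg_mul_integral hψ 0
  simp only [mul_zero, Complex.ofReal_zero, zero_mul, Complex.exp_zero, one_mul, neg_zero,
    Real.exp_zero, Complex.ofReal_one] at h
  rw [hψ.eq_one 0 (by norm_num)] at h
  exact_mod_cast h.symm

/-- The exponent `(1 - 2πit)/Λ` of the slot powers `d^{-(1-2πit)/Λ}` (`Λ = log R` or `log x`); its real
part is `1/Λ` and its norm is `≤ (1 + 2π|t|)/Λ`. [cite: TaoTeravainen2021, Lemma 8.2 (8.10)–(8.11)] -/
def slotZ (Λ t : ℝ) : ℂ :=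
  (1 - 2 * π * t * Complex.I) / Λ

/-- `Re slotZ = 1/Λ`. [folklore] -/
theorem slotZ_re (Λ t : ℝ) : (slotZ Λ t).re = 1 / Λ := by
  unfold slotZ
  rw [show (1 - 2 * π * t * Complex.I : ℂ) / Λ = ((1 - 2 * π * t * Complex.I : ℂ)) * ((1 / Λ : ℝ) : ℂ) by
    push_cast; ring]
  rw [Complex.re_mul_ofReal]
  simp

/-- `‖slotZ Λ t‖ ≤ (1 + 2π|t|)/Λ` (`Λ > 0`). [folklore] -/
theorem norm_slotZ_le {Λ : ℝ} (hΛ : 0 < Λ) (t : ℝ) : ‖slotZ Λ t‖ ≤ (1 + 2 * π * |t|) / Λ := by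
  unfold slotZ
  rw [norm_div, Complex.norm_real, Real.norm_eq_abs, abs_of_pos hΛ]
  gcongr
  calc ‖(1 - 2 * π * t * Complex.I : ℂ)‖ ≤ ‖(1 : ℂ)‖ + ‖(2 * π * t * Complex.I : ℂ)‖ := norm_sub_le _ _
    _ = 1 + 2 * π * |t| := by
        rw [norm_one]
        simp [abs_of_pos Real.pi_pos]

/-- **(8.10), applied form**: for `d ≥ 1` and `R > 1`,
`ψ_{≤R}(d) = ψ(log d/log R) = ∫ d^{-(1-2πit)/log R} f(t) dt`.
[cite: TaoTeravainen2021, Lemma 8.2 (8.10)] -/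
theorem cutoffLE_eq_integral (hψ : IsSmoothCutoff ψ) {R : ℝ} (hR : 1 < R) {d : ℕ}
    (hd : 1 ≤ d) :
    ((cutoffLE ψ R d : ℝ) : ℂ) =
      ∫ t : ℝ, (d : ℂ) ^ (-(slotZ (Real.log R) t)) * leFourier ψ t := by
  have hlogR : 0 < Real.log R := Real.log_pos hR
  have hd0 : (d : ℂ) ≠ 0 := Nat.cast_ne_zero.mpr (by omega)
  set v : ℝ := Real.log d / Real.log R with hv
  rw [cutoffLE, psi_eq_exp_neg_mul_integral hψ v, ← integral_const_mul]
  refine integral_congr_ae (ae_of_all _ fun t => ?_)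
  dsimp only
  rw [← mul_assoc]
  congr 1
  -- `e^{-v} e^{2πitv} = d^{-(1-2πit)/log R}`
  rw [Complex.cpow_def_of_ne_zero hd0, Complex.ofReal_exp, ← Complex.exp_add]
  congr 1
  have hlogd : Complex.log (d : ℂ) = ((Real.log d : ℝ) : ℂ) := Complex.natCast_log.symm
  unfold slotZ
  rw [hlogd, hv]
  have hL : (Real.log R : ℂ) ≠ 0 := Complex.ofReal_ne_zero.mpr hlogR.ne'
  push_cast
  field_simp
  ring

end MainTerm

end TaoTeravainen

end Literature.Barriers.Parity
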